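import Summits.QuantumFields.BalabanUV.Beta.GAN24.InsertionChainDecay
import Summits.QuantumFields.BalabanUV.T4Continuum.Support.CTDecayEnd

/-!
# `BalabanUV.Beta.GAN24.InsertionChainDecayColour` — binder row G-an2-4 ∕ (CONV-C), route R7 «TWO CURRENCIES», PART 125: THE INSERTION CHAINS OF
# BAŁABAN's SHAPED PERTURBATION IN BOTH CURRENCIES.  PART 124's engine on the COLOUR tower `idx L M k × o` (free operator `Δ_a^{(k)} ⊗ 1`, King's
# averaging `Q_L ⊗ 1`, pairing `J_k ⊗ 1`): for EVERY colour perturbation family with `PerturbationLaws … κ₀ (C₂ρ^k)` (`L⁻¹ ≤ ρ < 1`) and the two weighted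
# letters at the canonical weights, every insertion order `n` has a convergent King-averaged unit-lattice image with King's (4.38) ∕ (CONV-C) shape
# `‖(c^{(n)}_{k+1} − c^{(n)}_k)(x,y)‖ ≤ B·(√ρ)^k·e^{−(κ∕2)·distKC(x,y)}`; and for NE2's TYPED model of Bałaban's `Δ_a(U) − Δ_a ⊗ 1` — `P_B = balabanPert (liftR Rg)
# (gaugeSlot Rg …)` (covariant Laplacian + covariant line-sum averaging + gauge term with site transports) — every letter but NE3's `LocalRate` is a tree
# theorem, so the u-derivative insertion chains `(𝒢^{(k)}P_{B,k})^n𝒢^{(k)}` of EVERY order carry the (CONV-C) shape under EXACTLY the binders of NE2's END of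
# record in the decay currency (`hreg`, `hNE3`, `a′ > 0`, `α, β ≤ η ≤ etaCT`) — NO coupling condition (the chains are polynomial in `P_B`), NO `hdec`
# (unit b2b-balaban-gan24-p3, gen 52; v1)

NOT IN PRINT; OUR PROOF ([folklore] composition BY NAME: PART 124 `GAN24/InsertionChainDecay` (`opNorm_conjMat_insertion_le`); PART 115 `GAN24/InsertionChainLaw`
(`towerLimitRate_insertion`, the abstract tower of every insertion order); NE2's `Spine/NE2ColourPerturbedLayer.freeTowerLaws_king_kron` (the colour `FreeTowerLaws`, a THEOREM);
the NE2 swarm's «Δ3-CT» chain `Support/CTAveragedTowerDecay` (`entryDecay_avgTow_of_conjInv`, `opNorm_conjMat_kron_inv_le_of_wCoercive`), `Support/CTKingTowerWeights`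
(canonical weights, `distKC`, `prtk_prtQK`, `opNorm_QlevKron_sq_le`), `Support/CTBalabanPertHbd.hPc_balabanPert_of_regular` (the conjugated (H-bd) of `P_B` modulo `hJ`, `hP₄`),
`Support/CTGaugeSlotDiffEnd.hP4diff_gaugeSlot_of_regular` (`hP₄`), `Support/CTConjDefectDischarge.conjDefect_calDalev_rho` (`hJ`), `Support/CTDecayEnd.numericBinders_CT` (every
numeric binder below `etaCT`), `Spine/NE2BalabanFinal.perturbationLaws_balaban_final` + `Spine/NE2BalabanThreshold.smallness_of_le` (the rate half of `P_B`, conditional on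
NE3's `LocalRate` BY NAME); the row owner's `Support/DecayRateInterpolation.decayRate_of_towerLimitRate` (the join).  [King1986] Lemma 4.5 (4.38) p. 674 is the printed SHAPE of
the conclusion; [Balaban1985BackgroundPropagators] (3.23)–(3.26) p. 394–395 locate WHERE the background enters Bałaban's `Δ_a(U)` — shapes only, nothing printed is a
hypothesis).
HONEST FRAMING (cell contract, verbatim): «discharging `BetaPertH` makes Bałaban's UV stability UNCONDITIONAL — a real constructive-QFT result; it is NOT the
continuum limit and NOT the Clay problem.»  HONEST DEPENDENCY (verbatim): «continuum YM on T⁴ ⇐ BetaPertH ∧ nine spine estimates (0/9 proved); BetaPertH ⇐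
(D1) ∧ (D4) ∧ CAP+tail; G-an2-4 gates asym, D1 and NE2/3/4.»

WHY THIS FILE.  Gen 51's handoff: «NE3's binder for Bałaban's shaped operator — then 115–123 apply to `Δ_a(U)` BY NAME».  NE2's resolvent route TYPED Bałaban's
perturbation on the colour layer and proved its `PerturbationLaws` conditionally on node NE3's `LocalRate` (`perturbationLaws_balaban_final`); the NE2 swarm proved
its conjugated (H-bd) at the canonical Combes–Thomas weights (`CTBalabanPertHbd`, `CTGaugeSlotDiffEnd`) and discharged every numeric binder below one threshold
`etaCT(|o|, d, a, a′)` (`CTDecayEnd`).  PART 124 made the insertion-chain engine currency-agnostic.  THIS FILE runs it on the colour tower: §1–§2 the dictionary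
and the decay half for ANY colour perturbation family and ANY order, §3 the rate half at a general rate `ρ ∈ [L⁻¹, 1)` and the join, §4 the instance on `P_B`.  Result:
the u-DERIVATIVE constituents (every Taylor coefficient in the background strength) of NE2's model of Bałaban's background propagator, King-averaged to the unit
lattice, CONVERGE at a geometric rate WITH exponential off-diagonal decay, constants free of the level and of the volume — under the END of record's binders and
nothing else.  This is the (CONV-C) shape for the u-derivative sector at the reach of the tree's objects; what separates it from (CONV-C) proper is typed, not
hidden: NE3's `LocalRate` (OPEN), the (3.35)-class `hreg`, King's (non-covariant) outer averaging, the model status of `P_B` (no B0 identification with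
[B9] (3.23)–(3.26) as printed), and the Table-T vertices (R7 S1).

WHAT THIS FILE PROVES (0 sorry, 0 `def`, nothing cited; `o` a finite colour index, `Δ_a^{(k)} = calDalev k`, weights `p ↦ ρ_{k,y}(p.1)` read through `Prod.fst`, `dist = distKC`):
* §1 **`hdecC_of_conjBound`** (ANY level operators `X_k` on `idx L M k × o`): a centre-uniform bound `‖conjMat κ ρ_{k,y} ρ_{k,y} (X k)‖ ≤ K` (`κ ≥ 0`) gives
  `∀ k, EntryDecay distKC ((L^d)^k·(Q⊗1)^{(k)}X_k(Q⊗1)^{(k)ᴴ}) (K·e^{2κ}) κ` — `CTKingTowerWeights.hdec_pertCovC_of_conjInv` for general `X`.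
* §2 **`hdecC_insertion_of_wCoercive`**: the UN-LIFTED weighted coercivity `hW : ∀ k y, WCoercive (Δ_a^{(k)}) κ ρ_{k,y} γw` and the conjugated (H-bd)
  `hPc : ∀ k y, ‖c(P_k)·c((Δ_a^{(k)}⊗1)⁻¹)‖ ≤ κ′` give `hdec` for the `n`-th insertion tower of `(Δ_a^{(k)}⊗1, P_k)` with `(γw⁻¹κ′^n e^{2κ}, κ)`.
* §3 **`towerLimitRate_insertion_kingC`** (`L⁻¹ ≤ ρ < 1`; `PerturbationLaws (Δ_a⊗1) P (J⊗1) κ₀ (C₂ρ^k)` ⟹ `TowerLimitRate … C_n ρ` for every order `n`,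
  `C_n = (n+1)κ₀^nCJ + nκ₀^{n−1}C₂ + κ₀^n·2dCst` — PART 115 over `freeTowerLaws_king_kron`, the free letters `L^{−k} ≤ ρ^k` by `NE2ColourPerturbedLayerRate.const_mul_invPow_le`); **`decayStations_insertion_kingC`** (the JOIN:
  limit, limit decay `(B, κ)`, `DecayRate … (√(2B·C_n∕(1−ρ))) (κ∕2) (√ρ)`, `TwoLevelDecayRate … (√(2B·2C_n∕(1−ρ))) (κ∕2) (√ρ)`, `B = γw⁻¹κ′^n e^{2κ}`).
* §4 (BAŁABAN's SHAPED PERTURBATION `P_B = balabanPert (liftR Rg) (gaugeSlot Rg (QuT (siteT Rg)) Q1 a′)`) **`hPc_balabanPert_CT`** (the conjugated (H-bd) of `P_B` at the rate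
  `kappaCT(|o|, d, a, a′)` with EVERY numeric binder discharged: `hreg`, `a′ > 0`, `α, β ≤ η ≤ etaCT` ⟹ `≤ K_B := κ_col,CT + κ_avg,CT + κ₄,CT`);
  **`decayStations_insertion_balaban_CT`** (`L ≥ 2`, `d ≥ 1`): under `hreg`, `hNE3 : LocalRate … C L⁻¹` (node NE3, OPEN, BY NAME), `0 ≤ C`, `0 < a′`, `α ≤ η`, `β ≤ η`,
  `η ≤ etaCT o d a a′` — NOTHING ELSE — for EVERY order `n` the King-averaged unit-lattice images of `((Δ_a^{(k)}⊗1)⁻¹P_{B,k})^n(Δ_a^{(k)}⊗1)⁻¹` converge to a limit with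
  entry decay `((γ_D − J₀)⁻¹K_B^n e^{2κ_CT}, κ_CT)` and obey King's two shapes at `(κ_CT∕2, √(L⁻¹))`; **`twoLevelDecayRate_insertion_balaban_CT`**: the literal display
  `∃ B₀, ∀ k x y, ‖(c^{(n)}_{k+1} − c^{(n)}_k)(x,y)‖ ≤ B₀·(√(L⁻¹))^k·e^{−(κ_CT∕2)·distKC(x,y)}`.
WHAT IT DOES NOT DO: discharge NE3's `LocalRate` or the (3.35)-class; identify `P_B` with [B9] (3.23)–(3.26) as printed (dictionary B0, asserted by no file); Bałaban's
covariant OUTER averaging `Q_k(U)` (King's `Q⊗1` here) and his Table-T vertices (R7 S1); mixed chains; infinite volume; a number for `κ_CT`.  SUPPLIER work (junction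
R7 × NE2's Δ3-CT chain × ROOT B); no consumer of record; NEVER «G-an2-4 closed»; NOT (CONV-C), NOT NE2, NOT D1, NOT `BetaPertH`, NOT continuum, NOT Clay.
Records: `HOME/b2b-balaban-gan24-p3/gen52/README.md`.
-/

noncomputable section

open scoped BigOperators ComplexConjugate Matrix Matrix.Norms.L2Operator Kronecker
open Filter Topology

namespace Summit.QuantumFields.BalabanUV.Beta.GAN24.InsertionChainDecayColour

open Literature.MathematicalPhysics.QuantumFieldTheory.Balaban1983to89.B5Prop11Plancherel (Cst Cst_nonneg Tor fine)
open Literature.MathematicalPhysics.QuantumFieldTheory.Balaban1983to89.B5G183RateUnitTower (lev)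
open Literature.MathematicalPhysics.QuantumFieldTheory.Balaban1983to89.T4EtaRateMin (LocalRate)
open Summit.QuantumFields.BalabanUV.T4Continuum
open Summit.QuantumFields.BalabanUV.T4Continuum.CovariantAveragingTower (avgTow TowerLimitRate)
open Summit.QuantumFields.BalabanUV.T4Continuum.BalabanAveragedTowerUnit (idx Qlev one_le_lev')
open Summit.QuantumFields.BalabanUV.T4Continuum.BackgroundResolventTower (PerturbationLaws)
open Summit.QuantumFields.BalabanUV.T4Continuum.KingPairingPlantedLaw (JpcT calDalev CJ CJ_nonneg)
open Summit.QuantumFields.BalabanUV.T4Continuum.CTWeightedCoercivity (conjMat WCoercive)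
open Summit.QuantumFields.BalabanUV.T4Continuum.CTAveragedTowerDecay (entryDecay_avgTow_of_conjInv opNorm_conjMat_kron_inv_le_of_wCoercive)
open Summit.QuantumFields.BalabanUV.T4Continuum.CTKingTowerWeights (rho distK distKC rho_nonpos_of_prtk distK_sub_two_le_rho prtk_prtQK opNorm_QlevKron_sq_le)
open Summit.QuantumFields.BalabanUV.T4Continuum.CTConjugatedHbd (wCoercive_calDa_of_conjDefect)
open Summit.QuantumFields.BalabanUV.T4Continuum.CTConjDefectDischarge (conjDefect_calDalev_rho max_JA_lt_gamD)
open Summit.QuantumFields.BalabanUV.T4Continuum.CTBalabanPertHbd (hPc_balabanPert_of_regular)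
open Summit.QuantumFields.BalabanUV.T4Continuum.CTSmallFieldThreshold (etaCT etaCT_le_etaStar)
open Summit.QuantumFields.BalabanUV.T4Continuum.CTDecayEnd (numericBinders_CT)
open Summit.QuantumFields.BalabanUV.T4Continuum.CTAdmissibleRate (kappaCT)
open Summit.QuantumFields.BalabanUV.T4Continuum.CTVectorPropagator (JA)
open Summit.QuantumFields.BalabanUV.T4Continuum.CTCovariantLaplacianDecay (kappaColCT)
open Summit.QuantumFields.BalabanUV.T4Continuum.CTAveragingSummandHbd (kappaAvgCT)
open Summit.QuantumFields.BalabanUV.T4Continuum.CTGaugeSlotDiff (kappa4CTd hP4diff_gaugeSlot_of_regular)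
open Summit.QuantumFields.BalabanUV.T4Continuum.DirichletRegionTower (gamD gamD_pos)
open Summit.QuantumFields.BalabanUV.T4Continuum.BlockSumDecay (prtk prtQ prtQK QlevKron_indicator)
open Summit.QuantumFields.BalabanUV.T4Continuum.DecayRateInterpolation (EntryDecay DecayRate TwoLevelDecayRate decayRate_of_towerLimitRate)
open Summit.QuantumFields.BalabanUV.T4Continuum.NE2ColourPerturbedLayer (freeTowerLaws_king_kron)
open Summit.QuantumFields.BalabanUV.T4Continuum.NE2ColourPerturbedLayerRate (const_mul_invPow_le)
open Summit.QuantumFields.BalabanUV.T4Continuum.NE2FromNE3 (bgReadings)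
open Summit.QuantumFields.BalabanUV.T4Continuum.RegularBackgroundTower (RegularTransporters regClass betaNE3)
open Summit.QuantumFields.BalabanUV.T4Continuum.GaugeTermScalarData (QuT Q1)
open Summit.QuantumFields.BalabanUV.T4Continuum.RegularSiteTransporters (siteT)
open Summit.QuantumFields.BalabanUV.T4Continuum.NestedContourTransport (theta0)
open Summit.QuantumFields.BalabanUV.T4Continuum.NE2BalabanRoot (balabanPert)
open Summit.QuantumFields.BalabanUV.T4Continuum.NE2BalabanGauge (gaugeSlot liftR)
open Summit.QuantumFields.BalabanUV.T4Continuum.NE2BalabanLayerSharp (kappaBs C2Bs)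
open Summit.QuantumFields.BalabanUV.T4Continuum.NE2BalabanWiring (epsR CdeltaR)
open Summit.QuantumFields.BalabanUV.T4Continuum.NE2BalabanFinal (kappa4F C4F tauR perturbationLaws_balaban_final)
open Summit.QuantumFields.BalabanUV.T4Continuum.NE2BalabanThreshold (etaStar smallness_of_le)
open Summit.QuantumFields.BalabanUV.T4Continuum.GramPerturbationLaw (C2gram)
open Summit.QuantumFields.BalabanUV.T4Continuum.CovariantAveragingSummand (kappaQ)
open Summit.QuantumFields.BalabanUV.Beta.GAN24.InsertionChainLaw (towerLimitRate_insertion)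
open Summit.QuantumFields.BalabanUV.Beta.GAN24.InsertionChainDecay (opNorm_conjMat_insertion_le insertionConst_nonneg)

variable {d : ℕ} (L : ℕ) [NeZero L] (M : Fin d → ℕ) [hM : ∀ μ, NeZero (M μ)] {o : Type*} [Fintype o] [DecidableEq o]

/-! ## §1 The Combes–Thomas dictionary on the colour tower, for any level operators -/

/-- **`hdecC_of_conjBound`** [our proof]: on the colour tower `idx L M k × o` (averagings `Q_L ⊗ 1`, weights read through `Prod.fst`), a centre-uniform bound
`‖conjMat κ ρ_{k,y} ρ_{k,y} (X k)‖ ≤ K` (`κ ≥ 0`) on ANY level operators gives `EntryDecay distKC ((L^d)^k·(Q⊗1)^{(k)}X_k(Q⊗1)^{(k)ᴴ}) (K·e^{2κ}) κ` at every level —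
`CTKingTowerWeights.hdec_pertCovC_of_conjInv` with the perturbed inverse replaced by a general `X`. -/
theorem hdecC_of_conjBound {X : (k : ℕ) → Matrix (idx L M k × o) (idx L M k × o) ℂ} {κ K : ℝ} (hκ : 0 ≤ κ)
    (hK : ∀ (k : ℕ) (y : idx L M 0 × o),
      ‖conjMat κ (fun p : idx L M k × o => rho L M k y.1 p.1) (fun p : idx L M k × o => rho L M k y.1 p.1) (X k)‖ ≤ K) (k : ℕ) :
    EntryDecay (distKC L M o) (avgTow (fun k => Qlev L M k ⊗ₖ (1 : Matrix o o ℂ)) ((L : ℝ) ^ d) X k) (K * Real.exp (κ * 2)) κ := by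
  have hLd : (0 : ℝ) < (L : ℝ) ^ d := pow_pos (by exact_mod_cast Nat.pos_of_ne_zero (NeZero.ne L)) d
  refine entryDecay_avgTow_of_conjInv (X := X) (k := k) (dist := distKC L M o) (c := 2) (QlevKron_indicator L M o) hLd
    (opNorm_QlevKron_sq_le L M) hκ (fun (y : idx L M 0 × o) (p : idx L M k × o) => rho L M k y.1 p.1) (hK k) ?_ ?_
  · intro y u hu
    rw [prtk_prtQK] at hu
    exact rho_nonpos_of_prtk L M k y.1 u.1 (by rw [← hu])
  · intro x y u hu
    rw [prtk_prtQK] at hu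
    have hx : prtk (prtQ L M) k u.1 = x.1 := by rw [← hu]
    exact distK_sub_two_le_rho L M k x.1 y.1 u.1 hx

variable (a : ℝ) (ha : 0 < a)

/-! ## §2 The decay half for every insertion order on the colour tower -/

/-- **`hdecC_insertion_of_wCoercive`** [our proof]: the UN-LIFTED `U = 1` weighted coercivity `hW` of `Δ_a^{(k)}` and the conjugated (H-bd) `hPc` of a colour
perturbation family against `(Δ_a^{(k)}⊗1)⁻¹`, both at the canonical weights, give for every order `n` and level `k`
`EntryDecay distKC ((L^d)^k·(Q⊗1)^{(k)}((Δ_a^{(k)}⊗1)⁻¹P_k)^n(Δ_a^{(k)}⊗1)⁻¹(Q⊗1)^{(k)ᴴ}) (γw⁻¹κ′^n·e^{2κ}) κ`. -/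
theorem hdecC_insertion_of_wCoercive {P : (k : ℕ) → Matrix (idx L M k × o) (idx L M k × o) ℂ} {κ γw κ' : ℝ} (hκ : 0 ≤ κ) (hγ : 0 < γw)
    (hW : ∀ (k : ℕ) (y : idx L M 0), WCoercive (calDalev L M a ha k) κ (rho L M k y) γw)
    (hPc : ∀ (k : ℕ) (y : idx L M 0 × o),
      ‖conjMat κ (fun p : idx L M k × o => rho L M k y.1 p.1) (fun p : idx L M k × o => rho L M k y.1 p.1) (P k)
        * conjMat κ (fun p : idx L M k × o => rho L M k y.1 p.1) (fun p : idx L M k × o => rho L M k y.1 p.1)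
          (calDalev L M a ha k ⊗ₖ (1 : Matrix o o ℂ))⁻¹‖ ≤ κ')
    (n k : ℕ) :
    EntryDecay (distKC L M o)
      (avgTow (fun k => Qlev L M k ⊗ₖ (1 : Matrix o o ℂ)) ((L : ℝ) ^ d)
        (fun k => ((calDalev L M a ha k ⊗ₖ (1 : Matrix o o ℂ))⁻¹ * P k) ^ n * (calDalev L M a ha k ⊗ₖ (1 : Matrix o o ℂ))⁻¹) k)
      (γw⁻¹ * κ' ^ n * Real.exp (κ * 2)) κ :=
  hdecC_of_conjBound L M hκ
    (fun k y => opNorm_conjMat_insertion_le (opNorm_conjMat_kron_inv_le_of_wCoercive (o := o) (hW k y.1) hγ) (hPc k y) n) k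

/-! ## §3 The rate half at a general rate `ρ ∈ [L⁻¹, 1)` on the colour tower, and the join -/

/-- **`towerLimitRate_insertion_kingC` — THE RATE HALF OF EVERY INSERTION ORDER ON THE COLOUR TOWER AT RATE `ρ`** [our proof] (`L⁻¹ ≤ ρ < 1`, so `L ≥ 2`): a colour
perturbation family with `PerturbationLaws (Δ_a⊗1) P (J⊗1) κ₀ (C₂ρ^k)` has, for every order `n`, `TowerLimitRate (Q⊗1) L^d (k ↦ ((Δ_a^{(k)}⊗1)⁻¹P_k)^n(Δ_a^{(k)}⊗1)⁻¹) C_n ρ`,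
`C_n = (n+1)κ₀^nCJ + nκ₀^{n−1}C₂ + κ₀^n·2dCst` — PART 115's abstract tower over NE2's colour `FreeTowerLaws` (a theorem), the `U = 1` letters read at rate `ρ`. -/
theorem towerLimitRate_insertion_kingC {P : (k : ℕ) → Matrix (idx L M k × o) (idx L M k × o) ℂ} {κ₀ C₂ ρ : ℝ}
    (hρ : ((L : ℝ)⁻¹) ≤ ρ) (hρ1 : ρ < 1)
    (hpert : PerturbationLaws (fun k => calDalev L M a ha k ⊗ₖ (1 : Matrix o o ℂ)) P (fun k => JpcT L M k ⊗ₖ (1 : Matrix o o ℂ)) κ₀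
      (fun k => C₂ * ρ ^ k)) (n : ℕ) :
    TowerLimitRate (fun k => Qlev L M k ⊗ₖ (1 : Matrix o o ℂ)) ((L : ℝ) ^ d)
      (fun k => ((calDalev L M a ha k ⊗ₖ (1 : Matrix o o ℂ))⁻¹ * P k) ^ n * (calDalev L M a ha k ⊗ₖ (1 : Matrix o o ℂ))⁻¹)
      (((n + 1) * κ₀ ^ n * CJ d a + n * κ₀ ^ (n - 1) * C₂) + κ₀ ^ n * (2 * d * Cst d a)) ρ := by
  have hr : (0 : ℝ) < (L : ℝ) ^ d := pow_pos (by exact_mod_cast Nat.pos_of_ne_zero (NeZero.ne L)) d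
  have hd0 : (0 : ℝ) ≤ 2 * d * Cst d a := by have := Cst_nonneg d a; positivity
  have h := towerLimitRate_insertion hr (freeTowerLaws_king_kron L M a ha o) hpert hρ1
    (fun k => const_mul_invPow_le L hd0 hρ k) (fun k => const_mul_invPow_le L (CJ_nonneg d a) hρ k) (fun k => le_rfl)
    (fun k => show (0 : ℝ) ≤ 0 * ρ ^ k by rw [zero_mul]) n
  simp only [mul_zero, add_zero] at h
  exact h

/-- `κ₀ ≥ 0` and `C₂ ≥ 0` are forced by `PerturbationLaws … κ₀ (C₂ρ^k)` (read at level `0`). [folklore] -/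
theorem nonneg_of_perturbationLawsC {P : (k : ℕ) → Matrix (idx L M k × o) (idx L M k × o) ℂ} {κ₀ C₂ ρ : ℝ}
    (hpert : PerturbationLaws (fun k => calDalev L M a ha k ⊗ₖ (1 : Matrix o o ℂ)) P (fun k => JpcT L M k ⊗ₖ (1 : Matrix o o ℂ)) κ₀
      (fun k => C₂ * ρ ^ k)) : 0 ≤ κ₀ ∧ 0 ≤ C₂ := by
  refine ⟨(norm_nonneg _).trans (hpert.opNorm_P_mul_inv_le 0), ?_⟩
  have h := (norm_nonneg _).trans (hpert.consistent_le 0)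
  rwa [pow_zero, mul_one] at h

/-- **`decayStations_insertion_kingC` — THE JOIN ON THE COLOUR TOWER** [our proof] (`L⁻¹ ≤ ρ < 1`): `PerturbationLaws (Δ_a⊗1) P (J⊗1) κ₀ (C₂ρ^k)` (rate half),
`hW` + `hPc` at a rate `κ ≥ 0` (decay half) ⟹ for every order `n` the King-averaged unit-lattice images `c^{(n)}_k` of `((Δ_a^{(k)}⊗1)⁻¹P_k)^n(Δ_a^{(k)}⊗1)⁻¹` converge to a
limit `c^{(n)}_∞` with `EntryDecay distKC c^{(n)}_∞ B κ`, `B = γw⁻¹κ′^n e^{2κ}`, and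
`‖(c^{(n)}_k − c^{(n)}_∞)(x,y)‖ ≤ √(2B·C_n∕(1−ρ))·(√ρ)^k·e^{−(κ∕2)·distKC(x,y)}`, `‖(c^{(n)}_{k+1} − c^{(n)}_k)(x,y)‖ ≤ √(2B·2C_n∕(1−ρ))·(√ρ)^k·e^{−(κ∕2)·distKC(x,y)}`.
[cite: King1986, Lemma 4.5 (4.38) p.674 (shape of the conclusion; scalar template)] -/
theorem decayStations_insertion_kingC {P : (k : ℕ) → Matrix (idx L M k × o) (idx L M k × o) ℂ} {κ₀ C₂ ρ : ℝ}
    (hρ : ((L : ℝ)⁻¹) ≤ ρ) (hρ1 : ρ < 1)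
    (hpert : PerturbationLaws (fun k => calDalev L M a ha k ⊗ₖ (1 : Matrix o o ℂ)) P (fun k => JpcT L M k ⊗ₖ (1 : Matrix o o ℂ)) κ₀
      (fun k => C₂ * ρ ^ k))
    {κ γw κ' : ℝ} (hκ : 0 ≤ κ) (hγ : 0 < γw) (hW : ∀ (k : ℕ) (y : idx L M 0), WCoercive (calDalev L M a ha k) κ (rho L M k y) γw)
    (hPc : ∀ (k : ℕ) (y : idx L M 0 × o),
      ‖conjMat κ (fun p : idx L M k × o => rho L M k y.1 p.1) (fun p : idx L M k × o => rho L M k y.1 p.1) (P k)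
        * conjMat κ (fun p : idx L M k × o => rho L M k y.1 p.1) (fun p : idx L M k × o => rho L M k y.1 p.1)
          (calDalev L M a ha k ⊗ₖ (1 : Matrix o o ℂ))⁻¹‖ ≤ κ')
    (n : ℕ) :
    ∃ clim : Matrix (idx L M 0 × o) (idx L M 0 × o) ℂ,
      Tendsto (avgTow (fun k => Qlev L M k ⊗ₖ (1 : Matrix o o ℂ)) ((L : ℝ) ^ d)
        (fun k => ((calDalev L M a ha k ⊗ₖ (1 : Matrix o o ℂ))⁻¹ * P k) ^ n * (calDalev L M a ha k ⊗ₖ (1 : Matrix o o ℂ))⁻¹)) atTop (𝓝 clim) ∧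
      EntryDecay (distKC L M o) clim (γw⁻¹ * κ' ^ n * Real.exp (κ * 2)) κ ∧
      DecayRate (distKC L M o) (avgTow (fun k => Qlev L M k ⊗ₖ (1 : Matrix o o ℂ)) ((L : ℝ) ^ d)
        (fun k => ((calDalev L M a ha k ⊗ₖ (1 : Matrix o o ℂ))⁻¹ * P k) ^ n * (calDalev L M a ha k ⊗ₖ (1 : Matrix o o ℂ))⁻¹)) clim
        (Real.sqrt (2 * (γw⁻¹ * κ' ^ n * Real.exp (κ * 2))
          * ((((n + 1) * κ₀ ^ n * CJ d a + n * κ₀ ^ (n - 1) * C₂) + κ₀ ^ n * (2 * d * Cst d a)) / (1 - ρ))))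
        (κ / 2) (Real.sqrt ρ) ∧
      TwoLevelDecayRate (distKC L M o) (avgTow (fun k => Qlev L M k ⊗ₖ (1 : Matrix o o ℂ)) ((L : ℝ) ^ d)
        (fun k => ((calDalev L M a ha k ⊗ₖ (1 : Matrix o o ℂ))⁻¹ * P k) ^ n * (calDalev L M a ha k ⊗ₖ (1 : Matrix o o ℂ))⁻¹))
        (Real.sqrt (2 * (γw⁻¹ * κ' ^ n * Real.exp (κ * 2))
          * (2 * (((n + 1) * κ₀ ^ n * CJ d a + n * κ₀ ^ (n - 1) * C₂) + κ₀ ^ n * (2 * d * Cst d a)) / (1 - ρ))))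
        (κ / 2) (Real.sqrt ρ) := by
  have hρ0 : (0 : ℝ) ≤ ρ := (inv_nonneg.mpr (Nat.cast_nonneg _)).trans hρ
  obtain ⟨hκ₀, hC₂⟩ := nonneg_of_perturbationLawsC L M a ha hpert
  exact decayRate_of_towerLimitRate hρ0 hρ1 (insertionConst_nonneg (d := d) a hκ₀ hC₂ n) (towerLimitRate_insertion_kingC L M a ha hρ hρ1 hpert n)
    (hdecC_insertion_of_wCoercive L M a ha hκ hγ hW hPc n)

/-! ## §4 Bałaban's shaped perturbation `P_B`: every insertion order in both currencies, under the END of record's binders -/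

section Balaban

variable {Rg : (k : ℕ) → Fin d → (Tor (fine (lev L k) M) → Matrix o o ℂ)} {α β : ℝ}

/-- **`hPc_balabanPert_CT` — THE CONJUGATED (H-bd) OF `P_B` WITH EVERY NUMERIC BINDER DISCHARGED** [our proof]: on the (3.35)-class with `α, β ≤ η ≤ etaCT o d a a′`
(`a′ > 0`), at the rate `κ_CT = kappaCT |o| d a a′` and `J₀ = max (JA d a 1 κ_CT 1) 0`:
`‖c(P_{B,k})·c((Δ_a^{(k)}⊗1)⁻¹)‖ ≤ K_B := κ_col,CT + κ_avg,CT + κ₄,CT` at the canonical weights, every level and centre — `CTBalabanPertHbd.hPc_balabanPert_of_regular` with `hJ`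
from `conjDefect_calDalev_rho` and `hP₄` from `hP4diff_gaugeSlot_of_regular`, their numeric binders from `CTDecayEnd.numericBinders_CT` (read at `t = 0`). -/
theorem hPc_balabanPert_CT (hd : 1 ≤ d) (hreg : RegularTransporters L M (liftR L M Rg) α β) {a' : ℝ} (ha' : 0 < a') {η : ℝ} (hαη : α ≤ η)
    (hβη : β ≤ η) (hη : η ≤ etaCT o d a a') (k : ℕ) (y : idx L M 0 × o) :
    ‖conjMat (kappaCT (Fintype.card o) d a a') (fun p : idx L M k × o => rho L M k y.1 p.1) (fun p : idx L M k × o => rho L M k y.1 p.1)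
          (balabanPert L M a (liftR L M Rg) (gaugeSlot L M Rg (QuT L M o (siteT L M Rg)) (Q1 L M o) a') k)
        * conjMat (kappaCT (Fintype.card o) d a a') (fun p : idx L M k × o => rho L M k y.1 p.1) (fun p : idx L M k × o => rho L M k y.1 p.1)
          (calDalev L M a ha k ⊗ₖ (1 : Matrix o o ℂ))⁻¹‖
      ≤ kappaColCT o d a α β (d * (α ^ 2 + 2 * β)) (max (JA d a 1 (kappaCT (Fintype.card o) d a a') 1) 0) (kappaCT (Fintype.card o) d a a')
        + kappaAvgCT (Fintype.card o) d a α (max (JA d a 1 (kappaCT (Fintype.card o) d a a') 1) 0) (kappaCT (Fintype.card o) d a a')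
        + kappa4CTd (Fintype.card o) d a a' α (max (JA d a 1 (kappaCT (Fintype.card o) d a a') 1) 0) (kappaCT (Fintype.card o) d a a') := by
  have ht0 : ‖(0 : ℂ)‖ ≤ 1 := by rw [norm_zero]; exact zero_le_one
  obtain ⟨-, hγ', hδ', hJA, hγ, hγ1, hδU, hδ1, -⟩ := numericBinders_CT L M a hreg ha' hαη hβη hη ht0
  have hJ := conjDefect_calDalev_rho L M a ha one_pos hγ' hδ'
  have hJγ := max_JA_lt_gamD a hJA
  have hP₄ := hP4diff_gaugeSlot_of_regular L M a ha hd hreg ha' hJ hJγ hγ hγ1 hδU hδ1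
  exact hPc_balabanPert_of_regular L M a ha hreg hJ (le_max_right _ _) hJγ hP₄ k y

/-- **`decayStations_insertion_balaban_CT` — THE u-DERIVATIVE INSERTION CHAINS OF BAŁABAN's SHAPED PERTURBATION IN BOTH CURRENCIES** [our proof] (`L ≥ 2`, `d ≥ 1`).
Displayed binders: `hreg` (row B5's (3.35)-class of the site-based bond transporters `Rg`), `hNE3 : LocalRate … C L⁻¹` (node NE3, OPEN, BY NAME), `0 ≤ C`, `0 < a′`,
`α ≤ η`, `β ≤ η`, `η ≤ etaCT o d a a′` — NOTHING ELSE (no coupling condition: the chains are polynomial in `P_B`; no `hdec`; no numeric binder).  Conclusion, for EVERY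
order `n`: the King-averaged unit-lattice images `c^{(n)}_k = (L^d)^k·(Q⊗1)^{(k)}((Δ_a^{(k)}⊗1)⁻¹P_{B,k})^n(Δ_a^{(k)}⊗1)⁻¹(Q⊗1)^{(k)ᴴ}` — the `n`-th Taylor coefficients in the
background strength of NE2's model of Bałaban's background propagator — converge to a limit `c^{(n)}_∞` with `EntryDecay distKC c^{(n)}_∞ ((γ_D − J₀)⁻¹K_B^n e^{2κ_CT}) κ_CT` and
obey King's shapes `DecayRate … (κ_CT∕2) (√(L⁻¹))`, `TwoLevelDecayRate … (κ_CT∕2) (√(L⁻¹))` with the displayed constants (`C_n` PART 115's constant at the record's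
`κ_B = kappaBs …`, `C₂^B = C2Bs …`).  Model level (no B0); CONDITIONAL on NE3 + the (3.35)-class + the threshold; NOT NE2, NOT (CONV-C).
[cite: King1986, Lemma 4.5 (4.38) p.674 (shape); Balaban1985BackgroundPropagators, (3.26) p.395 (where the background enters — shape)] -/
theorem decayStations_insertion_balaban_CT (hL : 2 ≤ L) (hd : 1 ≤ d) (hreg : RegularTransporters L M (liftR L M Rg) α β) {C : ℝ} (hC : 0 ≤ C)
    (hNE3 : LocalRate (bgReadings L M (regClass L M (liftR L M Rg))) C ((L : ℝ)⁻¹)) {a' : ℝ} (ha' : 0 < a') {η : ℝ} (hαη : α ≤ η)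
    (hβη : β ≤ η) (hη : η ≤ etaCT o d a a') (n : ℕ) :
    ∃ clim : Matrix (idx L M 0 × o) (idx L M 0 × o) ℂ,
      Tendsto (avgTow (fun k => Qlev L M k ⊗ₖ (1 : Matrix o o ℂ)) ((L : ℝ) ^ d)
        (fun k => ((calDalev L M a ha k ⊗ₖ (1 : Matrix o o ℂ))⁻¹
            * balabanPert L M a (liftR L M Rg) (gaugeSlot L M Rg (QuT L M o (siteT L M Rg)) (Q1 L M o) a') k) ^ n
          * (calDalev L M a ha k ⊗ₖ (1 : Matrix o o ℂ))⁻¹)) atTop (𝓝 clim) ∧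
      EntryDecay (distKC L M o) clim
        ((gamD d a - max (JA d a 1 (kappaCT (Fintype.card o) d a a') 1) 0)⁻¹
          * (kappaColCT o d a α β (d * (α ^ 2 + 2 * β)) (max (JA d a 1 (kappaCT (Fintype.card o) d a a') 1) 0) (kappaCT (Fintype.card o) d a a')
              + kappaAvgCT (Fintype.card o) d a α (max (JA d a 1 (kappaCT (Fintype.card o) d a a') 1) 0) (kappaCT (Fintype.card o) d a a')
              + kappa4CTd (Fintype.card o) d a a' α (max (JA d a 1 (kappaCT (Fintype.card o) d a a') 1) 0) (kappaCT (Fintype.card o) d a a')) ^ n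
          * Real.exp (kappaCT (Fintype.card o) d a a' * 2)) (kappaCT (Fintype.card o) d a a') ∧
      DecayRate (distKC L M o) (avgTow (fun k => Qlev L M k ⊗ₖ (1 : Matrix o o ℂ)) ((L : ℝ) ^ d)
        (fun k => ((calDalev L M a ha k ⊗ₖ (1 : Matrix o o ℂ))⁻¹
            * balabanPert L M a (liftR L M Rg) (gaugeSlot L M Rg (QuT L M o (siteT L M Rg)) (Q1 L M o) a') k) ^ n
          * (calDalev L M a ha k ⊗ₖ (1 : Matrix o o ℂ))⁻¹)) clim
        (Real.sqrt (2 * ((gamD d a - max (JA d a 1 (kappaCT (Fintype.card o) d a a') 1) 0)⁻¹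
          * (kappaColCT o d a α β (d * (α ^ 2 + 2 * β)) (max (JA d a 1 (kappaCT (Fintype.card o) d a a') 1) 0) (kappaCT (Fintype.card o) d a a')
              + kappaAvgCT (Fintype.card o) d a α (max (JA d a 1 (kappaCT (Fintype.card o) d a a') 1) 0) (kappaCT (Fintype.card o) d a a')
              + kappa4CTd (Fintype.card o) d a a' α (max (JA d a 1 (kappaCT (Fintype.card o) d a a') 1) 0) (kappaCT (Fintype.card o) d a a')) ^ n
          * Real.exp (kappaCT (Fintype.card o) d a a' * 2))
          * ((((n + 1) * (kappaBs o d a α β (kappaQ d a (a : ℂ) (epsR o d α)) (kappa4F d a a' α β)) ^ n * CJ d a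
                + n * (kappaBs o d a α β (kappaQ d a (a : ℂ) (epsR o d α)) (kappa4F d a a' α β)) ^ (n - 1)
                  * C2Bs o d L a α β C
                      (a * C2gram (Cst d a) 1 (epsR o d α) (2 * d * Cst d a) (CJ d a) (Cst d a) (CdeltaR o d a α (theta0 d α (betaNE3 o C))))
                      (C4F o d L a a' α β C))
              + (kappaBs o d a α β (kappaQ d a (a : ℂ) (epsR o d α)) (kappa4F d a a' α β)) ^ n * (2 * d * Cst d a)) / (1 - (L : ℝ)⁻¹))))
        (kappaCT (Fintype.card o) d a a' / 2) (Real.sqrt ((L : ℝ)⁻¹)) ∧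
      TwoLevelDecayRate (distKC L M o) (avgTow (fun k => Qlev L M k ⊗ₖ (1 : Matrix o o ℂ)) ((L : ℝ) ^ d)
        (fun k => ((calDalev L M a ha k ⊗ₖ (1 : Matrix o o ℂ))⁻¹
            * balabanPert L M a (liftR L M Rg) (gaugeSlot L M Rg (QuT L M o (siteT L M Rg)) (Q1 L M o) a') k) ^ n
          * (calDalev L M a ha k ⊗ₖ (1 : Matrix o o ℂ))⁻¹))
        (Real.sqrt (2 * ((gamD d a - max (JA d a 1 (kappaCT (Fintype.card o) d a a') 1) 0)⁻¹
          * (kappaColCT o d a α β (d * (α ^ 2 + 2 * β)) (max (JA d a 1 (kappaCT (Fintype.card o) d a a') 1) 0) (kappaCT (Fintype.card o) d a a')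
              + kappaAvgCT (Fintype.card o) d a α (max (JA d a 1 (kappaCT (Fintype.card o) d a a') 1) 0) (kappaCT (Fintype.card o) d a a')
              + kappa4CTd (Fintype.card o) d a a' α (max (JA d a 1 (kappaCT (Fintype.card o) d a a') 1) 0) (kappaCT (Fintype.card o) d a a')) ^ n
          * Real.exp (kappaCT (Fintype.card o) d a a' * 2))
          * (2 * (((n + 1) * (kappaBs o d a α β (kappaQ d a (a : ℂ) (epsR o d α)) (kappa4F d a a' α β)) ^ n * CJ d a
                + n * (kappaBs o d a α β (kappaQ d a (a : ℂ) (epsR o d α)) (kappa4F d a a' α β)) ^ (n - 1)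
                  * C2Bs o d L a α β C
                      (a * C2gram (Cst d a) 1 (epsR o d α) (2 * d * Cst d a) (CJ d a) (Cst d a) (CdeltaR o d a α (theta0 d α (betaNE3 o C))))
                      (C4F o d L a a' α β C))
              + (kappaBs o d a α β (kappaQ d a (a : ℂ) (epsR o d α)) (kappa4F d a a' α β)) ^ n * (2 * d * Cst d a)) / (1 - (L : ℝ)⁻¹))))
        (kappaCT (Fintype.card o) d a a' / 2) (Real.sqrt ((L : ℝ)⁻¹)) := by
  have hL1 : (1 : ℝ) < L := by exact_mod_cast (lt_of_lt_of_le one_lt_two hL : 1 < L)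
  have hρ1 : ((L : ℝ)⁻¹) < 1 := inv_lt_one_of_one_lt₀ hL1
  have ht0 : ‖(0 : ℂ)‖ ≤ 1 := by rw [norm_zero]; exact zero_le_one
  obtain ⟨hκ0, hγ', hδ', hJA, -, -, -, -, -⟩ := numericBinders_CT L M a hreg ha' hαη hβη hη ht0
  -- the rate half: `PerturbationLaws` of `P_B` at rate `L⁻¹`, its two B4 thresholds from `η ≤ etaCT ≤ etaStar`
  obtain ⟨h1, h2, -, -, -, -, -, -⟩ :=
    smallness_of_le (o := o) (d := d) a ha.le ha' hreg.nonneg.1 hreg.nonneg.2 hαη hβη (hη.trans (etaCT_le_etaStar o d a a'))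
  have hpert := perturbationLaws_balaban_final L M a ha hd hreg hC hNE3 ha' h1 h2
  -- the decay half: `hW` from `hJ`, `hPc` from §4
  have hJγ := max_JA_lt_gamD a hJA
  have hW : ∀ (k : ℕ) (y : idx L M 0), WCoercive (calDalev L M a ha k) (kappaCT (Fintype.card o) d a a') (rho L M k y)
      (gamD d a - max (JA d a 1 (kappaCT (Fintype.card o) d a a') 1) 0) :=
    fun k y => wCoercive_calDa_of_conjDefect (lev L k) (one_le_lev' L k) M a ha (conjDefect_calDalev_rho L M a ha one_pos hγ' hδ' k y)
  exact decayStations_insertion_kingC L M a ha le_rfl hρ1 hpert hκ0.le (sub_pos.mpr hJγ) hW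
    (hPc_balabanPert_CT L M a ha hd hreg ha' hαη hβη hη) n

/-- **`twoLevelDecayRate_insertion_balaban_CT` — THE LITERAL KING (4.38) ∕ (CONV-C) DISPLAY FOR THE u-DERIVATIVE CHAINS OF `P_B`** [our proof] (`L ≥ 2`, `d ≥ 1`): under the
END of record's binders `hreg`, `hNE3`, `0 ≤ C`, `0 < a′`, `α, β ≤ η ≤ etaCT` and for every order `n`:
`∃ B₀, ∀ k x y, ‖(c^{(n)}_{k+1} − c^{(n)}_k)(x,y)‖ ≤ B₀·(√(L⁻¹))^k·e^{−(κ_CT∕2)·distKC(x,y)}` — a geometric rate in the level AND an exponential decay in the unit-lattice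
distance at a rate `κ_CT(|o|, d, a, a′)∕2` free of the torus, the scale, the level and the order.  CONDITIONAL on NE3; model level; NOT NE2, NOT (CONV-C). -/
theorem twoLevelDecayRate_insertion_balaban_CT (hL : 2 ≤ L) (hd : 1 ≤ d) (hreg : RegularTransporters L M (liftR L M Rg) α β) {C : ℝ}
    (hC : 0 ≤ C) (hNE3 : LocalRate (bgReadings L M (regClass L M (liftR L M Rg))) C ((L : ℝ)⁻¹)) {a' : ℝ} (ha' : 0 < a') {η : ℝ}
    (hαη : α ≤ η) (hβη : β ≤ η) (hη : η ≤ etaCT o d a a') (n : ℕ) :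
    ∃ B₀ : ℝ, ∀ (k : ℕ) (x y : idx L M 0 × o),
      ‖(avgTow (fun k => Qlev L M k ⊗ₖ (1 : Matrix o o ℂ)) ((L : ℝ) ^ d)
            (fun k => ((calDalev L M a ha k ⊗ₖ (1 : Matrix o o ℂ))⁻¹
                * balabanPert L M a (liftR L M Rg) (gaugeSlot L M Rg (QuT L M o (siteT L M Rg)) (Q1 L M o) a') k) ^ n
              * (calDalev L M a ha k ⊗ₖ (1 : Matrix o o ℂ))⁻¹) (k + 1)
          - avgTow (fun k => Qlev L M k ⊗ₖ (1 : Matrix o o ℂ)) ((L : ℝ) ^ d)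
            (fun k => ((calDalev L M a ha k ⊗ₖ (1 : Matrix o o ℂ))⁻¹
                * balabanPert L M a (liftR L M Rg) (gaugeSlot L M Rg (QuT L M o (siteT L M Rg)) (Q1 L M o) a') k) ^ n
              * (calDalev L M a ha k ⊗ₖ (1 : Matrix o o ℂ))⁻¹) k) x y‖
        ≤ B₀ * Real.sqrt ((L : ℝ)⁻¹) ^ k * Real.exp (-(kappaCT (Fintype.card o) d a a' / 2 * distKC L M o x y)) := by
  obtain ⟨_, _, _, _, h2⟩ := decayStations_insertion_balaban_CT L M a ha hL hd hreg hC hNE3 ha' hαη hβη hη n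
  exact ⟨_, h2⟩

end Balaban

end Summit.QuantumFields.BalabanUV.Beta.GAN24.InsertionChainDecayColour

end
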